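import Literature.NumberTheory.ConnesMoscovici2022.UVProlateInhomogeneousToolkit
import Literature.NumberTheory.ConnesMoscovici2022.UVProlateMaxDomainRegularity
import Literature.NumberTheory.ConnesMoscovici2022.UVProlateMaxDomainEndpoints
import Literature.NumberTheory.ConnesMoscovici2022.UVProlateSADomain

/-!
# Connes–Moscovici 2022, Theorem 1.6 (ii) for `P_λ`: `W_sa` commutes with the cutoff projection

LINE 1 — FRAMING. RH-FREE corpus literature (cell rh-crit, C1 Connes–Consani/Moscovici corpus,
row O2 `UVProlateSpectrum`: the self-adjointness theory of the prolate wave operator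
`W_λ = −∂ₓ(λ² − x²)∂ₓ + (2πλx)²`; sequel material with no leaf / binder role in any route).
bears_on: LADDER-RH W-C/W-P.  WHAT THIS IS NOT: any claim about `ζ` or RH; nothing here bears on
the truth of RH.  Theorems only: 0 `def`s, 0 named facts, no `sorry`; the named fact
`CM22_thm_1_6` (a conjunction of (i)–(iv)) is NOT discharged here — this file proves ONE of its
conjuncts, `CommutesWith W (cutoffProj λ)`, as a stand-alone theorem.

## Source

A. Connes, H. Moscovici, *The UV prolate spectrum matches the zeros of zeta*, PNAS 119 (2022)
[ConnesMoscovici2022], Theorem 1.6 (ii) = arXiv:2112.05500 Theorem 2.6 (ii) (held text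
`paper-arxiv-2112.05500`, chunk p0006:L73–L75; proof L82–L90):

> (ii) `W_sa` commutes with the projections `P_λ` and `P̂_λ`.

with `P_λ` = multiplication by `1_{[−λ, λ]}` (the tree's `ConnesConsani2021.cutoffProj`) and
`W_sa` = the restriction of `W_max` to `𝓛_β` (the tree's `IsProlateSA` / `prolateSA`).

## What is proved, and how (deviation from print flagged)

* §1 `cutoffProj_mem_prolateMax_of_tendsto` — for `ξ ∈ dom W_max` whose regular representative
  `g` (`UVProlateMaxDomainRegularity.exists_regular_repr`, seat cc-t6) satisfies the boundary
  condition (1.19) at `λ⁻` and `(−λ)⁺`: `P_λ ξ ∈ dom W_max` and `W_max(P_λ ξ) = P_λ W_max ξ`.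
  This is the printed computation of Lemma 1.3 ("`⟨W(P_λ f), φ⟩ = ∫_{−λ}^{λ} f (Wφ) = … =
  ∫_{−λ}^{λ} (Wf) φ`, using twice integration by parts, together with the fact that `(λ² − x²)φ′`
  and `(λ² − x²)f′` vanish on the boundary", chunk p0004:L110–p0005:L9) run on `[x, y] ⊂ (−λ, λ)`
  with Green's identity in FTC form (`intervalIntegral_green_of_contDiffOn`, no second
  derivative of `g` needed), the boundary terms being killed by (1.19) and the one-sided limits
  of `g` at `±λ` (`exists_tendsto_left_lam_of_ftc` / `exists_tendsto_right_neg_lam_of_ftc`, seat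
  cc-t6), then `intervalIntegral_eq_zero_of_boundary_tendsto_zero` and the weak-equation
  characterisation of `dom W_max` (`exists_prolateMax_eq_of_forall_integral`).
* §2 `ProlateBC.indicator_Ioo` — `1_{(−λ,λ)}·g` satisfies (1.19)–(1.21) when `g` satisfies (1.19)
  from inside (outside `[−λ, λ]` everything vanishes).
* §3 `cutoffProj_mem_prolateSASet` (`P_λ 𝓛_β ⊆ 𝓛_β` with `W_max P_λ = P_λ W_max` there) and the
  headline **`CM22_thm_1_6_ii_cutoffProj : 0 < λ → IsProlateSA λ W → CommutesWith W (cutoffProj λ)`**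
  (+ `prolateSA_commutesWith_cutoffProj`).

DEVIATION (made explicit): the printed proof of (ii) writes every element of `𝓛_β` as an element
of `dom W_min` plus a combination of the deficiency vectors `β_±, β̂_±` (Lemma 1.5) and invokes
Lemma 1.3 for both parts; here the Lemma-1.3 computation is applied directly to the regular
representative of a general `ξ ∈ 𝓛_β`, so neither Lemma 1.5 nor the basis of the deficiency space
is used.  The `P̂_λ` half of (ii) needs the Fourier invariance of `𝓛_β` (clause (i)) and is not
addressed in this file.

Cell rh-crit seat cc-t14 g3; inputs by seats cc-t6 (regular representative, one-sided limits),
cc-t8 (`prolateSchwartz_apply'`, weak identities), cc-t14 g2 (`UVProlateSADomain`).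
-/

noncomputable section

open Complex Set MeasureTheory Filter Topology intervalIntegral SchwartzMap
open scoped Real Topology InnerProductSpace ContDiff

namespace Literature.NumberTheory.ConnesMoscovici2022

open Literature.NumberTheory.ConnesConsani2021 Literature.NumberTheory.ConnesConsani2024

variable {lam : ℝ}

/-- `ℝ ∖ {±λ}` is open. [folklore] -/
private theorem isOpen_S₀ (lam : ℝ) : IsOpen {x : ℝ | x ≠ lam ∧ x ≠ -lam} :=
  isOpen_ne.and isOpen_ne

/-! ## §1. The Green computation on `[−λ, λ]` for a regular representative satisfying (1.19) from inside -/

section Inner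

/-- `p` is continuous. [folklore] -/
private theorem continuous_pCoeff₁ (lam : ℝ) : Continuous (pCoeff lam) := by
  have e : pCoeff lam = fun y : ℝ ↦ (((lam ^ 2 - y ^ 2 : ℝ)) : ℂ) := rfl
  rw [e]; fun_prop

/-- `q` is continuous. [folklore] -/
private theorem continuous_qCoeff₁ (lam : ℝ) : Continuous (qCoeff lam) := by
  have e : qCoeff lam = fun y : ℝ ↦ ((((2 * π * lam) ^ 2 * y ^ 2 : ℝ)) : ℂ) := rfl
  rw [e]; fun_prop

/-- An a.e. representative of an `L²` function is integrable on compact intervals. [folklore] -/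
private theorem intervalIntegrable_repr (ξ : L2R) {g : ℝ → ℂ} (hae : ((ξ : ℝ → ℂ)) =ᵐ[volume] g)
    (x y : ℝ) : IntervalIntegrable g volume x y := by
  have hloc : LocallyIntegrable (fun t ↦ ((ξ : L2R) : ℝ → ℂ) t) :=
    (Lp.memLp (ξ : L2R)).locallyIntegrable (by norm_num)
  have h1 : IntegrableOn (fun t ↦ ((ξ : L2R) : ℝ → ℂ) t) (uIcc x y) :=
    hloc.integrableOn_isCompact isCompact_uIcc
  exact (h1.congr_fun_ae (ae_restrict_of_ae hae)).intervalIntegrable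

/-- **`W_max (P_λ ξ) = P_λ (W_max ξ)` whenever the boundary condition (1.19) holds at `±λ` from
inside `[−λ, λ]`.**  Let `ξ ∈ dom W_max` with regular representative `g` (`C¹` off `±λ`,
`p g′` a primitive of `q g − W_max ξ` on each component — `exists_regular_repr`) such that
`p g′ → 0` at `λ⁻` and at `(−λ)⁺`.  Then `P_λ ξ ∈ dom W_max` and `W_max(P_λ ξ) = P_λ W_max ξ`:
the printed computation "`⟨W(P_λ f), φ⟩ = ∫_{−λ}^{λ} f (Wφ) = … = ∫_{−λ}^{λ} (Wf) φ`, using twice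
integration by parts, together with the fact that `(λ² − x²)φ′` and `(λ² − x²)f′` vanish on the
boundary", carried out for the regular representative (Green's identity in FTC form on
`[x, y] ⊂ (−λ, λ)`, boundary terms killed by (1.19) and the one-sided limits of `g` at `±λ`).
[cite: ConnesMoscovici2022, proof of Lemma 1.3 and Thm 1.6 (ii) (= arXiv:2112.05500 Lemma 2.3, chunk p0004:L110–L120, p0005:L1–L9; Thm 2.6 (ii), chunk p0006:L82–L90)] -/
theorem cutoffProj_mem_prolateMax_of_tendsto (hlam : 0 < lam) (ξ : (prolateMax lam).domain)
    {g : ℝ → ℂ} (hae : ((ξ : L2R) : ℝ → ℂ) =ᵐ[volume] g)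
    (hg : ContDiffOn ℝ 1 g {x | x ≠ lam ∧ x ≠ -lam})
    (hftc : ∀ x y, x ≤ y → Icc x y ⊆ {x | x ≠ lam ∧ x ≠ -lam} →
      pCoeff lam y * deriv g y - pCoeff lam x * deriv g x =
        ∫ t in x..y, (qCoeff lam t * g t - (prolateMax lam ξ : L2R) t))
    (hL : Tendsto (fun x ↦ pCoeff lam x * deriv g x) (𝓝[<] lam) (𝓝 0))
    (hR : Tendsto (fun x ↦ pCoeff lam x * deriv g x) (𝓝[>] (-lam)) (𝓝 0)) :
    ∃ h : cutoffProj lam (ξ : L2R) ∈ (prolateMax lam).domain,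
      prolateMax lam ⟨cutoffProj lam (ξ : L2R), h⟩ = cutoffProj lam (prolateMax lam ξ) := by
  set S : Set ℝ := {x | x ≠ lam ∧ x ≠ -lam} with hS
  set η : ℝ → ℂ := fun t ↦ ((prolateMax lam ξ : L2R) : ℝ → ℂ) t with hη
  have hlam' : -lam < lam := by linarith
  have hIooS : Ioo (-lam) lam ⊆ S := fun x hx ↦ ⟨hx.2.ne, hx.1.ne'⟩
  -- one-sided limits of `g` at `±λ` from inside (step (α), seat cc-t6)
  obtain ⟨cL, hcL⟩ := exists_tendsto_left_lam_of_ftc hlam (ξ : L2R) (prolateMax lam ξ : L2R)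
    hae hg hftc hL
  obtain ⟨cR, hcR⟩ := exists_tendsto_right_neg_lam_of_ftc hlam (ξ : L2R)
    (prolateMax lam ξ : L2R) hae hg hftc hR
  -- local integrability of `η` and of `g`
  have hηloc : LocallyIntegrable η := (Lp.memLp (prolateMax lam ξ : L2R)).locallyIntegrable (by norm_num)
  have hηi : ∀ x y, IntervalIntegrable η volume x y := fun x y ↦
    (hηloc.integrableOn_isCompact isCompact_uIcc).intervalIntegrable
  have hgi : ∀ x y, IntervalIntegrable g volume x y := intervalIntegrable_repr (ξ : L2R) hae
  -- the key identity: for every Schwartz `θ`, `∫_{−λ}^{λ} ((Wθ) g − θ η) = 0`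
  have key : ∀ θ : 𝓢(ℝ, ℂ),
      ∫ t in (-lam)..lam, (prolateSchwartz lam θ t * g t - θ t * η t) = 0 := by
    intro θ
    have hθ2 : ContDiff ℝ 2 θ := θ.smooth 2
    have hθ1 : ContDiff ℝ 1 θ := θ.smooth 1
    set F : ℝ → ℂ := fun t ↦ prolateSchwartz lam θ t * g t - θ t * η t with hF
    set B : ℝ → ℂ := fun s ↦ θ s * (pCoeff lam s * deriv g s) - pCoeff lam s * deriv θ s * g s
      with hB
    -- Green on `[x, y] ⊂ (−λ, λ)`
    have hId : ∀ x ∈ Ioo (-lam) lam, ∀ y ∈ Ioo (-lam) lam, x ≤ y →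
        ∫ t in x..y, F t = B y - B x := by
      intro x hx y hy hxy
      have hsub : Icc x y ⊆ S := fun t ht ↦ hIooS ⟨hx.1.trans_le ht.1, ht.2.trans_lt hy.2⟩
      have hf : IntervalIntegrable (fun t ↦ qCoeff lam t * g t - η t) volume x y :=
        ((hgi x y).continuousOn_mul (continuous_qCoeff₁ lam).continuousOn).sub (hηi x y)
      have hG := intervalIntegral_green_of_contDiffOn lam hxy (isOpen_S₀ lam) hsub hθ2 hg
        (fun s hs ↦ hftc x s hs.1 (fun t ht ↦ hsub ⟨ht.1, ht.2.trans hs.2⟩)) hf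
      have e : ∀ t ∈ uIcc x y, F t =
          (-deriv (fun s ↦ pCoeff lam s * deriv θ s) t + qCoeff lam t * θ t) * g t
            - θ t * (qCoeff lam t * g t - (qCoeff lam t * g t - η t)) := by
        intro t _
        simp only [hF, prolateSchwartz_apply']
        ring
      rw [intervalIntegral.integral_congr e, hG]
    -- boundary terms vanish at `λ⁻` and `(−λ)⁺`
    have hpl : pCoeff lam lam = 0 := by simp [pCoeff]
    have hpm : pCoeff lam (-lam) = 0 := by simp [pCoeff]
    have hBl : Tendsto B (𝓝[<] lam) (𝓝 0) :=
      tendsto_green_boundary_zero lam hpl nhdsWithin_le_nhds hθ1 hL hcL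
    have hBm : Tendsto B (𝓝[>] (-lam)) (𝓝 0) :=
      tendsto_green_boundary_zero lam hpm nhdsWithin_le_nhds hθ1 hR hcR
    -- `F` is integrable on `[−λ, λ]`
    have hFi : IntervalIntegrable F volume (-lam) lam :=
      ((hgi _ _).continuousOn_mul (prolateSchwartz lam θ).continuous.continuousOn).sub
        ((hηi _ _).continuousOn_mul θ.continuous.continuousOn)
    exact intervalIntegral_eq_zero_of_boundary_tendsto_zero hlam' hFi hId hBm hBl
  -- the bilinear weak equation for `(P_λ ξ, P_λ η)`
  have hweak : ∀ θ : 𝓢(ℝ, ℂ),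
      ∫ x, prolateSchwartz lam θ x * (cutoffProj lam (ξ : L2R) : L2R) x =
        ∫ x, θ x * (cutoffProj lam (prolateMax lam ξ) : L2R) x := by
    intro θ
    have h1 : ∫ x, prolateSchwartz lam θ x * (cutoffProj lam (ξ : L2R) : L2R) x =
        ∫ x in (-lam)..lam, prolateSchwartz lam θ x * g x := by
      have e1 : (fun x ↦ prolateSchwartz lam θ x * (cutoffProj lam (ξ : L2R) : L2R) x) =ᵐ[volume]
          (Icc (-lam) lam).indicator (fun x ↦ prolateSchwartz lam θ x * g x) := by
        filter_upwards [cutoffProj_coeFn lam (ξ : L2R), hae] with x hx hx'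
        rw [hx]
        by_cases hmem : x ∈ Icc (-lam) lam
        · rw [indicator_of_mem hmem, indicator_of_mem hmem, hx']
        · rw [indicator_of_notMem hmem, indicator_of_notMem hmem, mul_zero]
      rw [integral_congr_ae e1, MeasureTheory.integral_indicator measurableSet_Icc,
        integral_Icc_eq_integral_Ioc,
        intervalIntegral.integral_of_le hlam'.le]
    have h2 : ∫ x, θ x * (cutoffProj lam (prolateMax lam ξ) : L2R) x =
        ∫ x in (-lam)..lam, θ x * η x := by
      have e1 : (fun x ↦ θ x * (cutoffProj lam (prolateMax lam ξ) : L2R) x) =ᵐ[volume]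
          (Icc (-lam) lam).indicator (fun x ↦ θ x * η x) := by
        filter_upwards [cutoffProj_coeFn lam (prolateMax lam ξ : L2R)] with x hx
        rw [hx]
        by_cases hmem : x ∈ Icc (-lam) lam
        · rw [indicator_of_mem hmem, indicator_of_mem hmem]
        · rw [indicator_of_notMem hmem, indicator_of_notMem hmem, mul_zero]
      rw [integral_congr_ae e1, MeasureTheory.integral_indicator measurableSet_Icc,
        integral_Icc_eq_integral_Ioc,
        intervalIntegral.integral_of_le hlam'.le]
    have hi1 : IntervalIntegrable (fun x ↦ prolateSchwartz lam θ x * g x) volume (-lam) lam :=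
      (hgi _ _).continuousOn_mul (prolateSchwartz lam θ).continuous.continuousOn
    have hi2 : IntervalIntegrable (fun x ↦ θ x * η x) volume (-lam) lam :=
      (hηi _ _).continuousOn_mul θ.continuous.continuousOn
    rw [h1, h2]
    have := key θ
    rw [intervalIntegral.integral_sub hi1 hi2] at this
    exact sub_eq_zero.1 this
  exact exists_prolateMax_eq_of_forall_integral lam hweak

end Inner

/-! ## §2. `P_λ` preserves `𝓛_β` -/

section Domain

/-- The indicator of `(−λ, λ)` times `g` satisfies the boundary conditions (1.19)–(1.21) whenever
`g` is differentiable off `±λ` and satisfies (1.19) from inside: outside `[−λ, λ]` the function is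
`0`, so the conditions at `±∞` and the outer halves of (1.19) are trivial ("each `β_±` is of the
form `P_λ f_±`"). [cite: ConnesMoscovici2022, Thm 1.6 (ii) and its proof (= arXiv:2112.05500 Thm 2.6 (ii), chunk p0006:L82–L90)] -/
theorem ProlateBC.indicator_Ioo (hlam : 0 < lam) {g : ℝ → ℂ}
    (hgd : DifferentiableOn ℝ g {x | x ≠ lam ∧ x ≠ -lam})
    (hL : Tendsto (fun x ↦ pCoeff lam x * deriv g x) (𝓝[<] lam) (𝓝 0))
    (hR : Tendsto (fun x ↦ pCoeff lam x * deriv g x) (𝓝[>] (-lam)) (𝓝 0)) :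
    ProlateBC lam ((Ioo (-lam) lam).indicator g) := by
  set S : Set ℝ := {x | x ≠ lam ∧ x ≠ -lam} with hS
  set G : ℝ → ℂ := (Ioo (-lam) lam).indicator g with hG
  have hlam' : -lam < lam := by linarith
  -- `G = g` near points of `(−λ, λ)`, `G = 0` near points outside `[−λ, λ]`
  have hin : ∀ x ∈ Ioo (-lam) lam, G =ᶠ[𝓝 x] g := fun x hx ↦ by
    filter_upwards [Ioo_mem_nhds hx.1 hx.2] with y hy
    rw [hG, indicator_of_mem hy]
  have hout : ∀ x, x ∉ Icc (-lam) lam → G =ᶠ[𝓝 x] fun _ ↦ (0 : ℂ) := fun x hx ↦ by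
    have hopen : IsOpen (Icc (-lam) lam)ᶜ := isClosed_Icc.isOpen_compl
    filter_upwards [hopen.mem_nhds hx] with y hy
    rw [hG, indicator_of_notMem (fun h ↦ hy (Ioo_subset_Icc_self h))]
  have hderiv_in : ∀ x ∈ Ioo (-lam) lam, deriv G x = deriv g x := fun x hx ↦ (hin x hx).deriv_eq
  have hderiv_out : ∀ x, x ∉ Icc (-lam) lam → deriv G x = 0 := fun x hx ↦ by
    rw [(hout x hx).deriv_eq, deriv_const]
  have hGout : ∀ x, x ∉ Icc (-lam) lam → G x = 0 := fun x hx ↦ (hout x hx).self_of_nhds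
  -- trichotomy off `±λ`
  have htri : ∀ x ∈ S, x ∈ Ioo (-lam) lam ∨ x ∉ Icc (-lam) lam := by
    intro x hx
    by_cases h1 : x < -lam
    · exact Or.inr fun h ↦ (not_le.2 h1) h.1
    by_cases h2 : lam < x
    · exact Or.inr fun h ↦ (not_le.2 h2) h.2
    · exact Or.inl ⟨lt_of_le_of_ne (not_lt.mp h1) (Ne.symm hx.2), lt_of_le_of_ne (not_lt.mp h2) hx.1⟩
  refine ⟨?_, ?_, ?_, ?_, ?_, ?_, ?_⟩
  · -- differentiable off `±λ`
    intro x hx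
    rcases htri x hx with h | h
    · exact (((hgd x hx).differentiableAt ((isOpen_S₀ lam).mem_nhds hx)).congr_of_eventuallyEq
        (hin x h)).differentiableWithinAt
    · exact ((differentiableAt_const (0 : ℂ)).congr_of_eventuallyEq (hout x h)).differentiableWithinAt
  · -- (1.19) at `λ`
    have hSsub : S ⊆ {lam}ᶜ := fun x hx ↦ mem_compl_singleton_iff.mpr hx.1
    refine Tendsto.mono_left (x := 𝓝[≠] lam) ?_ (nhdsWithin_mono _ hSsub)
    rw [← nhdsLT_sup_nhdsGT]
    refine Tendsto.sup ?_ ?_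
    · refine hL.congr' ?_
      have : Ioo (-lam) lam ∈ 𝓝[<] lam := by
        rw [← nhdsWithin_Ioo_eq_nhdsLT hlam']; exact self_mem_nhdsWithin
      filter_upwards [this] with x hx
      rw [hderiv_in x hx]
    · refine (tendsto_const_nhds (x := (0 : ℂ))).congr' ?_
      filter_upwards [self_mem_nhdsWithin] with x (hx : lam < x)
      rw [hderiv_out x (fun h ↦ (not_le.2 hx) h.2), mul_zero]
  · -- (1.19) at `−λ`
    have hSsub : S ⊆ {-lam}ᶜ := fun x hx ↦ mem_compl_singleton_iff.mpr hx.2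
    refine Tendsto.mono_left (x := 𝓝[≠] (-lam)) ?_ (nhdsWithin_mono _ hSsub)
    rw [← nhdsLT_sup_nhdsGT]
    refine Tendsto.sup ?_ ?_
    · refine (tendsto_const_nhds (x := (0 : ℂ))).congr' ?_
      filter_upwards [self_mem_nhdsWithin] with x (hx : x < -lam)
      rw [hderiv_out x (fun h ↦ (not_le.2 hx) h.1), mul_zero]
    · refine hR.congr' ?_
      have : Ioo (-lam) lam ∈ 𝓝[>] (-lam) := by
        rw [← nhdsWithin_Ioo_eq_nhdsGT hlam']; exact self_mem_nhdsWithin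
      filter_upwards [this] with x hx
      rw [hderiv_in x hx]
  · -- (1.20) at `+∞`: `evenFn G = 0` on `(λ, ∞)`
    refine (tendsto_const_nhds (x := (0 : ℂ))).congr' ?_
    filter_upwards [eventually_gt_atTop lam] with x hx
    have hx1 : x ∉ Icc (-lam) lam := fun h ↦ (not_le.2 hx) h.2
    have hzero : evenFn G =ᶠ[𝓝 x] fun _ ↦ (0 : ℂ) := by
      filter_upwards [(isOpen_Ioi (a := lam)).mem_nhds hx] with y (hy : lam < y)
      have hy1 : y ∉ Icc (-lam) lam := fun h ↦ (not_le.2 hy) h.2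
      have hy2 : -y ∉ Icc (-lam) lam := fun h ↦ by linarith [h.1]
      simp [evenFn, hGout y hy1, hGout (-y) hy2]
    rw [bcInfEven, hzero.deriv_eq, deriv_const, hzero.self_of_nhds]; simp
  · -- (1.20) at `−∞`
    refine (tendsto_const_nhds (x := (0 : ℂ))).congr' ?_
    filter_upwards [eventually_lt_atBot (-lam)] with x hx
    have hzero : evenFn G =ᶠ[𝓝 x] fun _ ↦ (0 : ℂ) := by
      filter_upwards [(isOpen_Iio (a := -lam)).mem_nhds hx] with y (hy : y < -lam)
      have hy1 : y ∉ Icc (-lam) lam := fun h ↦ (not_le.2 hy) h.1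
      have hy2 : -y ∉ Icc (-lam) lam := fun h ↦ by linarith [h.2]
      simp [evenFn, hGout y hy1, hGout (-y) hy2]
    rw [bcInfEven, hzero.deriv_eq, deriv_const, hzero.self_of_nhds]; simp
  · -- (1.21) at `+∞`
    refine (tendsto_const_nhds (x := (0 : ℂ))).congr' ?_
    filter_upwards [eventually_gt_atTop lam] with x hx
    have hzero : oddFn G =ᶠ[𝓝 x] fun _ ↦ (0 : ℂ) := by
      filter_upwards [(isOpen_Ioi (a := lam)).mem_nhds hx] with y (hy : lam < y)
      have hy1 : y ∉ Icc (-lam) lam := fun h ↦ (not_le.2 hy) h.2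
      have hy2 : -y ∉ Icc (-lam) lam := fun h ↦ by linarith [h.1]
      simp [oddFn, hGout y hy1, hGout (-y) hy2]
    rw [bcInfOdd, hzero.deriv_eq, deriv_const, hzero.self_of_nhds]; simp
  · -- (1.21) at `−∞`
    refine (tendsto_const_nhds (x := (0 : ℂ))).congr' ?_
    filter_upwards [eventually_lt_atBot (-lam)] with x hx
    have hzero : oddFn G =ᶠ[𝓝 x] fun _ ↦ (0 : ℂ) := by
      filter_upwards [(isOpen_Iio (a := -lam)).mem_nhds hx] with y (hy : y < -lam)
      have hy1 : y ∉ Icc (-lam) lam := fun h ↦ (not_le.2 hy) h.1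
      have hy2 : -y ∉ Icc (-lam) lam := fun h ↦ by linarith [h.2]
      simp [oddFn, hGout y hy1, hGout (-y) hy2]
    rw [bcInfOdd, hzero.deriv_eq, deriv_const, hzero.self_of_nhds]; simp

end Domain

/-! ## §3. Theorem 1.6 (ii), `P_λ` half -/

section Assembly

/-- **`P_λ` maps `𝓛_β` into `𝓛_β` and commutes with `W_max` there.**  For `ξ ∈ 𝓛_β = dom W_sa`:
`P_λ ξ ∈ dom W_max`, `W_max(P_λ ξ) = P_λ W_max ξ`, and `P_λ ξ ∈ 𝓛_β`.  Road (a deviation from the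
printed proof, which decomposes `𝓛_β = dom W_min + span{β_±, β̂_±}` by Lemma 1.5 and treats the
`β_± = P_λ f_±` by the computation of Lemma 1.3): the SAME computation is applied directly to the
regular representative of `ξ` (`exists_regular_repr`), whose boundary condition (1.19) kills the
Green boundary terms at `±λ` from inside; outside `[−λ, λ]` the cut-off function vanishes, so
(1.19) from outside and (1.20)–(1.21) hold trivially.
[cite: ConnesMoscovici2022, Thm 1.6 (ii) (= arXiv:2112.05500 Thm 2.6 (ii), chunk p0006:L73–L75; proof L82–L90)] -/
theorem cutoffProj_mem_prolateSASet (hlam : 0 < lam) (ξ : (prolateMax lam).domain)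
    (hξ : ((ξ : L2R)) ∈ prolateSASet lam) :
    ∃ h : cutoffProj lam (ξ : L2R) ∈ (prolateMax lam).domain,
      prolateMax lam ⟨cutoffProj lam (ξ : L2R), h⟩ = cutoffProj lam (prolateMax lam ξ) ∧
      cutoffProj lam (ξ : L2R) ∈ prolateSASet lam := by
  set S : Set ℝ := {x | x ≠ lam ∧ x ≠ -lam} with hSdef
  have hS : IsOpen S := isOpen_S₀ lam
  have hlam' : -lam < lam := by linarith
  have hIooS : Ioo (-lam) lam ⊆ S := fun x hx ↦ ⟨hx.2.ne, hx.1.ne'⟩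
  obtain ⟨-, g₀, hg₀, hBC⟩ := hξ
  obtain ⟨g, hae, hg, hftc, -, -⟩ := exists_regular_repr hlam ξ
  -- the boundary-condition representative and the regular representative agree off `±λ`
  have heq : EqOn g₀ g S :=
    eqOn_of_ae_eq_of_continuousOn (hg₀.symm.trans hae) hBC.differentiableOn.continuousOn
      hg.continuousOn
  have hderiv : ∀ x ∈ S, deriv g₀ x = deriv g x := fun x hx ↦
    Filter.EventuallyEq.deriv_eq (by
      filter_upwards [hS.mem_nhds hx] with y hy using heq hy)
  -- (1.19) for `g` at `λ⁻` and `(−λ)⁺`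
  have hL : Tendsto (fun x ↦ pCoeff lam x * deriv g x) (𝓝[<] lam) (𝓝 0) := by
    have h1 : Tendsto (fun x ↦ pCoeff lam x * deriv g x) (𝓝[S] lam) (𝓝 0) :=
      hBC.atLam.congr' (by
        filter_upwards [self_mem_nhdsWithin] with x hx
        rw [hderiv x hx])
    rw [← nhdsWithin_Ioo_eq_nhdsLT hlam']
    exact h1.mono_left (nhdsWithin_mono _ hIooS)
  have hR : Tendsto (fun x ↦ pCoeff lam x * deriv g x) (𝓝[>] (-lam)) (𝓝 0) := by
    have h1 : Tendsto (fun x ↦ pCoeff lam x * deriv g x) (𝓝[S] (-lam)) (𝓝 0) :=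
      hBC.atNegLam.congr' (by
        filter_upwards [self_mem_nhdsWithin] with x hx
        rw [hderiv x hx])
    rw [← nhdsWithin_Ioo_eq_nhdsGT hlam']
    exact h1.mono_left (nhdsWithin_mono _ hIooS)
  obtain ⟨hmem, hW⟩ := cutoffProj_mem_prolateMax_of_tendsto hlam ξ hae hg hftc hL hR
  refine ⟨hmem, hW, hmem, (Ioo (-lam) lam).indicator g, ?_,
    ProlateBC.indicator_Ioo hlam (hg.differentiableOn one_ne_zero) hL hR⟩
  have h1 : ((cutoffProj lam (ξ : L2R) : L2R) : ℝ → ℂ) =ᵐ[volume] (Icc (-lam) lam).indicator g := by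
    filter_upwards [cutoffProj_coeFn lam (ξ : L2R), hae] with x hx hx'
    rw [hx]
    by_cases hmem : x ∈ Icc (-lam) lam
    · rw [indicator_of_mem hmem, indicator_of_mem hmem, hx']
    · rw [indicator_of_notMem hmem, indicator_of_notMem hmem]
  exact h1.trans (indicator_ae_eq_of_ae_eq_set Ioo_ae_eq_Icc.symm)

/-- **[ConnesMoscovici2022, Thm 1.6 (ii)], `P_λ` half, PROVED: `W_sa` commutes with the cutoff
projection `P_λ`** — for every `W` with `IsProlateSA λ W` (i.e. `W = W_sa`, `isProlateSA_iff`),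
`P_λ` preserves `dom W = 𝓛_β` and `W (P_λ ξ) = P_λ (W ξ)`.  This is the conjunct
`CommutesWith W (cutoffProj lam)` of the named fact `CM22_thm_1_6`; the `P̂_λ` conjunct needs the
Fourier invariance of `𝓛_β` (clause (i)) and is not addressed here.
[cite: ConnesMoscovici2022, Thm 1.6 (ii) (= arXiv:2112.05500 Thm 2.6 (ii), chunk p0006:L73–L75; proof L82–L90)] -/
theorem CM22_thm_1_6_ii_cutoffProj (lam : ℝ) (hlam : 0 < lam) (W : L2R →ₗ.[ℂ] L2R)
    (hW : IsProlateSA lam W) : CommutesWith W (cutoffProj lam) := by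
  intro ξ
  have hξ : (ξ : L2R) ∈ prolateSASet lam := by
    rw [← hW.2]; exact ξ.2
  have hmax : (ξ : L2R) ∈ (prolateMax lam).domain := hW.1.1 ξ.2
  obtain ⟨hmem, hWmax, hSA⟩ := cutoffProj_mem_prolateSASet hlam ⟨ξ, hmax⟩ hξ
  have hdom : cutoffProj lam (ξ : L2R) ∈ W.domain := by
    have : cutoffProj lam (ξ : L2R) ∈ (W.domain : Set L2R) := by rw [hW.2]; exact hSA
    exact this
  refine ⟨hdom, ?_⟩
  have h1 : W ⟨cutoffProj lam (ξ : L2R), hdom⟩ =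
      prolateMax lam ⟨cutoffProj lam (ξ : L2R), hmem⟩ := hW.1.2 rfl
  have h2 : W ξ = prolateMax lam ⟨ξ, hmax⟩ := hW.1.2 rfl
  rw [h1, h2, hWmax]

/-- The same for the named operator `prolateSA λ` (= `W_sa`).
[cite: ConnesMoscovici2022, Thm 1.6 (ii) (= arXiv:2112.05500 Thm 2.6 (ii), chunk p0006:L73–L75)] -/
theorem prolateSA_commutesWith_cutoffProj (hlam : 0 < lam) :
    CommutesWith (prolateSA lam hlam) (cutoffProj lam) :=
  CM22_thm_1_6_ii_cutoffProj lam hlam _ (isProlateSA_prolateSA hlam)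

end Assembly

end Literature.NumberTheory.ConnesMoscovici2022

end
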